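import Summits.QuantumFields.YangMills.Theorems.BalabanUVNodesN19TargetOfClassGasDecorrelation
import Summits.QuantumFields.YangMills.Theorems.BalabanUVNodesN19MixingLetterOfTwoHoleDecoupling
import Summits.QuantumFields.YangMills.Theorems.BalabanUVNodesN19AgingLetterOfMixingLocality

/-!
# YM-DAG node N19 (= NE7 proper) — THE ROAD CLOSED IN THE TWO-HOLE CLASS-GAS MODEL, ONE `K`: from Kotecký–Preiss for both runs, source locality, the discounted
# two-run activity rate near the loop, cluster-decay SEPARATIONS of the old holes from the recent holes (`D₁`) and from the source (`D₂`), and two-run matching of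
# the RECENT structure (`η₂`) — to the bound on the two-run difference of the generating-function increments `|ΔgenFun| ≤ r + 2(4q + s' + η₂)`; NO class-uniform
# constant and NO hypothesis on the two-run contrast of the OLD block factors `F₁B ∕ F₁A`

Cell `pub-ymgap`, HUMAN RULING D-0062 (Track A), width seat `pub-ymgap-dag-n19-w2` (node n19 = NE7), generation g7 (R455 (A) rule (ii); CLAIM-11 on the cell
bus).  Route `Summits/QuantumFields/YangMills/Theses/BalabanUVNodes.lean`, key item K3⁸ `SpineGivenEndpointR13SepCoPHV` (stmt-QuantumFields-27366; aside
predecessor K3⁷ 20544); filed `--kind proof --supports … --as helper`.  COUNT-NEUTRAL.  THEOREMS ONLY (0 `def`, 0 `sorry`).  ADDITIVE — imports this seat's E (v1.1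
p629768: `responseMatching_of_classGas`), H (p629730: `quasiProduct_of_twoHole`, `localResponse_of_holeSource`), G (v1.1: `decorrelation_of_quasiProduct_of_localResponse_of_quasiOldContrast`)
and through them C (`abs_genFunIncr_sub_le_of_response_decorrelation`) and the tree's KP library; modifies nothing.

THE MODEL (one `K`; every object a BINDER).  Polymers `P`, incompatibility `inc`; a volume `Λ`; OLD holes `H₁ τ₁ ⊆ Λ` (`τ₁ ∈ T₁`) and RECENT holes `H₂ τ₂ ⊆ Λ`
(`τ₂ ∈ T₂`); the class `(τ₁, τ₂)` is the gas on `Λ ∖ (H₁ τ₁ ∪ H₂ τ₂)`; source-indexed REAL activities `wA s`, `wB s` (`|s| ≤ l₀`) of the two runs, class-independent,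
dominated by ONE profile `ω` obeying hypothesis (1) with weights `(a, d + e)` on `Λ`, source-local off the support `S`; source-free positive block factors `F₁A, F₂A, F₁B,
F₂B`; class weights `X_s(τ₁,τ₂) = F₁X τ₁ · F₂X τ₂ · Z(Λ ∖ (H₁ τ₁ ∪ H₂ τ₂); wX s).re`.  LETTERS: `r` ≥ the DISCOUNTED two-run activity budget on every class volume (B∕E);
`q ≥ e^{−D₁}·Σ_{H₁ τ₁} a` where `D₁` separates (in `Σ(d+e)`) every cluster joining an old hole to a recent hole (H §3, BOTH runs); `s' ≥ 2e^{−D₂}·Σ_{H₁ τ₁} a` where `D₂`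
separates old holes from the source on `Λ ∖ H₂ τ₂` (H §5, run A); `η₂ ≥` the oscillation over `τ₂` of the RECENT two-run contrast
`log(F₂B∕F₂A)(τ₂) + log Z_B^0(Λ∖H₂τ₂) − log Z_A^0(Λ∖H₂τ₂)` about a constant `c₂` (two-run matching of RECENT structure — small in the T4 design, where recent = born late;
a BINDER).  CONCLUSION: `|(log Σ B_t − log Σ B_0) − (log Σ A_t − log Σ A_0)| ≤ r + 2·(4q + s' + η₂)` — FILE C's increment bound with (RM) radius `r` and (DC) radius
`2(s + s' + ζ)`, `s = 2q` (MIX), `ζ = η₂ + 2q` (quasi-old contrast: both runs' two-hole errors + the recent contrast).  The OLD contrast `log(F₁B∕F₁A)(τ₁) +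
log Z_B(Λ∖H₁) − log Z_A(Λ∖H₁)` — window-key-core's extensive, law-separating object — is the `u(τ₁)` of G §5 and is NOT constrained.

WHAT IS KERNEL-CHECKED.  `kpd_mono` (hypothesis (1) restricts to sub-volumes) · ★★★ `abs_genFunIncr_sub_le_of_twoHoleClassGas` (the statement above).  Along `K` the bound feeds
FILE C's `matchingModConstants_of_genFun_increments`-type packaging (`target_of_responseDecorrelationReading` ∕ J's scheme-level forms) with `Σ_K (r_K + 2(4q_K + s'_K + η₂,K)) < ∞`.

HONEST FRAMING.  A MODEL theorem: the two-hole class-gas representation of the two runs' keyed class weights, the common profile, the separations `D₁, D₂`, the rate `r`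
and the recent matching `η₂` are HYPOTHESIS SHAPES produced by nobody for Bałaban's runs (whether the spine reading of record admits them is NODE O's ∕ the n19–n20
lanes' question); ZERO Bałaban content; NE7 NOT PRINTED for d = 4 ∕ NOT proved; N19 NOT discharged; K3⁸ 27366 OPEN, not claimed — stub 2 is `Core`-typed and NOT served
here; counts UNMOVED (typed 28∕28 · discharged 5∕27, A 5∕28); no count claim.  One finite four-torus programme at fixed ε; R4 closes the conditional finite-𝕋⁴ rung
`BalabanLadder.UV` only — NOT infinite volume, NOT OS on ℝ⁴, NOT the Yang–Mills mass gap, NOT the Clay problem.  0 `def`; 0 `sorry`; standard axioms.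
-/

noncomputable section

open Finset
open scoped BigOperators

namespace Summit.QuantumFields.YangMills.BalabanUVNodes.N19TwoHoleClassGasRoad

open Literature.Probability.LatticeModels
open Summit.QuantumFields.YangMills.BalabanUVNodes.N19TargetOfDecorrelationReading (abs_genFunIncr_sub_le_of_response_decorrelation)
open Summit.QuantumFields.YangMills.BalabanUVNodes.N19TargetOfClassGasDecorrelation (responseMatching_of_classGas)
open Summit.QuantumFields.YangMills.BalabanUVNodes.N19MixingLetterOfTwoHoleDecoupling (quasiProduct_of_twoHole localResponse_of_holeSource)
open Summit.QuantumFields.YangMills.BalabanUVNodes.N19AgingLetterOfMixingLocality (decorrelation_of_quasiProduct_of_localResponse_of_quasiOldContrast)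

variable {P : Type*} [DecidableEq P] {inc : P → P → Prop} [DecidableRel inc]

omit [DecidableEq P] in
/-- Hypothesis (1) with a dominating profile restricts to every sub-volume (the sum over fewer incompatible polymers is smaller). [folklore] -/
theorem kpd_mono {ω a d : P → ℝ} {Λ L : Finset P} (hL : L ⊆ Λ) (hω : ∀ γ, 0 ≤ ω γ)
    (hdom : ∀ γ ∈ Λ, ∑ γ' ∈ Λ with inc γ' γ, ω γ' * Real.exp (a γ' + d γ') ≤ a γ) :
    ∀ γ ∈ L, ∑ γ' ∈ L with inc γ' γ, ω γ' * Real.exp (a γ' + d γ') ≤ a γ := fun γ hγ =>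
  (Finset.sum_le_sum_of_subset_of_nonneg (Finset.filter_subset_filter _ hL) fun γ' _ _ => mul_nonneg (hω γ') (Real.exp_nonneg _)).trans
    (hdom γ (hL hγ))

variable [Std.Refl inc] [Std.Symm inc] {ι₁ ι₂ : Type*}

/-- ★★★ **THE INCREMENT BOUND IN THE TWO-HOLE CLASS-GAS MODEL** (one `K`; see the module docstring for the model and the letters).  Conclusion: FILE C's two-run bound on
the generating-function increments of the totals over the product class set `T₁ ×ˢ T₂`, with (RM) radius `r` and (DC) radius `2(2q + s' + (η₂ + 2q))`. [folklore] -/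
theorem abs_genFunIncr_sub_le_of_twoHoleClassGas {T₁ : Finset ι₁} {T₂ : Finset ι₂} {Λ S : Finset P} {H₁ : ι₁ → Finset P} {H₂ : ι₂ → Finset P}
    {wA wB : ℝ → P → ℂ} {ω a d e m : P → ℝ} {F₁A F₁B : ι₁ → ℝ} {F₂A F₂B : ι₂ → ℝ} {l₀ r q s' η₂ c₂ D₁ D₂ : ℝ}
    (hT₁ : T₁.Nonempty) (hT₂ : T₂.Nonempty) (hl₀ : 0 ≤ l₀)
    (ha : ∀ γ, 0 ≤ a γ) (hd : ∀ γ, 0 ≤ d γ) (he : ∀ γ, 0 ≤ e γ) (hω0 : ∀ γ, 0 ≤ ω γ)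
    (hωA : ∀ s, |s| ≤ l₀ → ∀ δ ∈ Λ, ‖wA s δ‖ ≤ ω δ) (hωB : ∀ s, |s| ≤ l₀ → ∀ δ ∈ Λ, ‖wB s δ‖ ≤ ω δ)
    (hdom : ∀ γ ∈ Λ, ∑ γ' ∈ Λ with inc γ' γ, ω γ' * Real.exp (a γ' + (d γ' + e γ')) ≤ a γ)
    (hAr : ∀ s γ, (wA s γ).im = 0) (hBr : ∀ s γ, (wB s γ).im = 0)
    (hSA : ∀ s, |s| ≤ l₀ → ∀ γ ∈ Λ, γ ∉ S → wA s γ = wA 0 γ) (hSB : ∀ s, |s| ≤ l₀ → ∀ γ ∈ Λ, γ ∉ S → wB s γ = wB 0 γ)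
    (hm : ∀ C ⊆ Λ, (C ∩ S).Nonempty → IsPolymerCluster inc C → ∀ δ ∈ C, m δ ≤ ∑ γ ∈ C, e γ)
    (hH₁ : ∀ τ₁ ∈ T₁, H₁ τ₁ ⊆ Λ) (hF₁A : ∀ τ₁ ∈ T₁, 0 < F₁A τ₁) (hF₁B : ∀ τ₁ ∈ T₁, 0 < F₁B τ₁)
    (hF₂A : ∀ τ₂ ∈ T₂, 0 < F₂A τ₂) (hF₂B : ∀ τ₂ ∈ T₂, 0 < F₂B τ₂)
    (hsep₁ : ∀ τ₁ ∈ T₁, ∀ τ₂ ∈ T₂, ∀ C ⊆ Λ, IsPolymerCluster inc C → (C ∩ H₁ τ₁).Nonempty → (C ∩ H₂ τ₂).Nonempty → D₁ ≤ ∑ γ ∈ C, (d γ + e γ))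
    (hsep₂ : ∀ τ₁ ∈ T₁, ∀ τ₂ ∈ T₂, ∀ C ⊆ Λ \ H₂ τ₂, IsPolymerCluster inc C → (C ∩ H₁ τ₁).Nonempty → (C ∩ S).Nonempty → D₂ ≤ ∑ γ ∈ C, (d γ + e γ))
    (hq : ∀ τ₁ ∈ T₁, Real.exp (-D₁) * ∑ γ ∈ H₁ τ₁, a γ ≤ q) (hs' : ∀ τ₁ ∈ T₁, 2 * (Real.exp (-D₂) * ∑ γ ∈ H₁ τ₁, a γ) ≤ s')
    (hr : ∀ s, |s| ≤ l₀ → ∀ τ₁ ∈ T₁, ∀ τ₂ ∈ T₂,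
      ∑ δ ∈ Λ \ (H₁ τ₁ ∪ H₂ τ₂), Real.exp (-m δ) * ((‖wA s δ - wB s δ‖ + ‖wA 0 δ - wB 0 δ‖) * Real.exp (a δ + (d δ + e δ))) ≤ r)
    (hRecent : ∀ τ₂ ∈ T₂, |Real.log (F₂B τ₂) - Real.log (F₂A τ₂) +
      (Real.log (polymerPartitionFunction inc (wB 0) (Λ \ H₂ τ₂)).re - Real.log (polymerPartitionFunction inc (wA 0) (Λ \ H₂ τ₂)).re) - c₂| ≤ η₂)
    {t : ℝ} (ht : |t| ≤ l₀) :
    |(Real.log (∑ τ ∈ T₁ ×ˢ T₂, F₁B τ.1 * F₂B τ.2 * (polymerPartitionFunction inc (wB t) (Λ \ (H₁ τ.1 ∪ H₂ τ.2))).re) -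
        Real.log (∑ τ ∈ T₁ ×ˢ T₂, F₁B τ.1 * F₂B τ.2 * (polymerPartitionFunction inc (wB 0) (Λ \ (H₁ τ.1 ∪ H₂ τ.2))).re)) -
      (Real.log (∑ τ ∈ T₁ ×ˢ T₂, F₁A τ.1 * F₂A τ.2 * (polymerPartitionFunction inc (wA t) (Λ \ (H₁ τ.1 ∪ H₂ τ.2))).re) -
        Real.log (∑ τ ∈ T₁ ×ˢ T₂, F₁A τ.1 * F₂A τ.2 * (polymerPartitionFunction inc (wA 0) (Λ \ (H₁ τ.1 ∪ H₂ τ.2))).re))| ≤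
      r + 2 * (2 * q + s' + (η₂ + 2 * q)) := by
  have h0 : |(0 : ℝ)| ≤ l₀ := by simpa using hl₀
  -- notation for the class weights
  set A : ℝ → ι₁ × ι₂ → ℝ := fun s τ => F₁A τ.1 * F₂A τ.2 * (polymerPartitionFunction inc (wA s) (Λ \ (H₁ τ.1 ∪ H₂ τ.2))).re with hAdef
  set B : ℝ → ι₁ × ι₂ → ℝ := fun s τ => F₁B τ.1 * F₂B τ.2 * (polymerPartitionFunction inc (wB s) (Λ \ (H₁ τ.1 ∪ H₂ τ.2))).re with hBdef
  have hde : ∀ γ, 0 ≤ d γ + e γ := fun γ => add_nonneg (hd γ) (he γ)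
  -- hypothesis (1) in `‖w‖`-form on `Λ` for each of the four families
  have h1 : ∀ {u : P → ℂ}, (∀ δ ∈ Λ, ‖u δ‖ ≤ ω δ) → ∀ γ ∈ Λ, ∑ γ' ∈ Λ with inc γ' γ, ‖u γ'‖ * Real.exp (a γ' + (d γ' + e γ')) ≤ a γ :=
    fun hu => kpd_of_norm_le hu hdom
  have mem : ∀ {τ : ι₁ × ι₂}, τ ∈ T₁ ×ˢ T₂ → τ.1 ∈ T₁ ∧ τ.2 ∈ T₂ := fun hτ => Finset.mem_product.1 hτ
  -- (RM) and positivity, per class and source value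
  have key : ∀ s, |s| ≤ l₀ → ∀ τ ∈ T₁ ×ˢ T₂, 0 < A s τ ∧ 0 < A 0 τ ∧ 0 < B s τ ∧ 0 < B 0 τ ∧
      |(Real.log (B s τ) - Real.log (B 0 τ)) - (Real.log (A s τ) - Real.log (A 0 τ))| ≤ r := by
    intro s hs τ hτ
    obtain ⟨h1m, h2m⟩ := mem hτ
    have hL : Λ \ (H₁ τ.1 ∪ H₂ τ.2) ⊆ Λ := Finset.sdiff_subset
    obtain ⟨p1, p2, p3, p4, hh⟩ := responseMatching_of_classGas (L := Λ \ (H₁ τ.1 ∪ H₂ τ.2)) (S := S) ha hd he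
      (fun δ hδ => hωA s hs δ (hL hδ)) (fun δ hδ => hωA 0 h0 δ (hL hδ)) (fun δ hδ => hωB s hs δ (hL hδ)) (fun δ hδ => hωB 0 h0 δ (hL hδ))
      (kpd_mono hL hω0 hdom) (hAr s) (hAr 0) (hBr s) (hBr 0) (fun γ hγ hγS => hSA s hs γ (hL hγ) hγS) (fun γ hγ hγS => hSB s hs γ (hL hγ) hγS)
      (fun C hC hCS hcl δ hδ => hm C (hC.trans hL) hCS hcl δ hδ) (mul_pos (hF₁A _ h1m) (hF₂A _ h2m)) (mul_pos (hF₁B _ h1m) (hF₂B _ h2m))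
    exact ⟨p1, p2, p3, p4, hh.trans (hr s hs _ h1m _ h2m)⟩
  -- two-hole decoupling for both runs at source 0 (unit prefactors), and the hole–source letter for run A
  have twoA : ∀ τ ∈ T₁ ×ˢ T₂, 0 < (polymerPartitionFunction inc (wA 0) Λ).re ∧ 0 < (polymerPartitionFunction inc (wA 0) (Λ \ H₁ τ.1)).re ∧
      0 < (polymerPartitionFunction inc (wA 0) (Λ \ H₂ τ.2)).re ∧ 0 < (polymerPartitionFunction inc (wA 0) (Λ \ (H₁ τ.1 ∪ H₂ τ.2))).re ∧
      |Real.log (1 * 1 * (polymerPartitionFunction inc (wA 0) (Λ \ (H₁ τ.1 ∪ H₂ τ.2))).re) -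
        Real.log ((1 * (polymerPartitionFunction inc (wA 0) (Λ \ H₁ τ.1)).re) *
          (1 * (polymerPartitionFunction inc (wA 0) (Λ \ H₂ τ.2)).re / (polymerPartitionFunction inc (wA 0) Λ).re))| ≤ q := by
    intro τ hτ
    obtain ⟨h1m, h2m⟩ := mem hτ
    obtain ⟨p0, p1, p2, p12, hh⟩ := quasiProduct_of_twoHole (d := fun γ => d γ + e γ) ha hde (h1 (hωA 0 h0)) (hAr 0) (hH₁ _ h1m) (H₂ := H₂ τ.2)
      (hsep₁ _ h1m _ h2m) one_pos one_pos
    exact ⟨p0, p1, p2, p12, hh.trans (hq _ h1m)⟩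
  have twoB : ∀ τ ∈ T₁ ×ˢ T₂, 0 < (polymerPartitionFunction inc (wB 0) Λ).re ∧ 0 < (polymerPartitionFunction inc (wB 0) (Λ \ H₁ τ.1)).re ∧
      0 < (polymerPartitionFunction inc (wB 0) (Λ \ H₂ τ.2)).re ∧ 0 < (polymerPartitionFunction inc (wB 0) (Λ \ (H₁ τ.1 ∪ H₂ τ.2))).re ∧
      |Real.log (1 * 1 * (polymerPartitionFunction inc (wB 0) (Λ \ (H₁ τ.1 ∪ H₂ τ.2))).re) -
        Real.log ((1 * (polymerPartitionFunction inc (wB 0) (Λ \ H₁ τ.1)).re) *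
          (1 * (polymerPartitionFunction inc (wB 0) (Λ \ H₂ τ.2)).re / (polymerPartitionFunction inc (wB 0) Λ).re))| ≤ q := by
    intro τ hτ
    obtain ⟨h1m, h2m⟩ := mem hτ
    obtain ⟨p0, p1, p2, p12, hh⟩ := quasiProduct_of_twoHole (d := fun γ => d γ + e γ) ha hde (h1 (hωB 0 h0)) (hBr 0) (hH₁ _ h1m) (H₂ := H₂ τ.2)
      (hsep₁ _ h1m _ h2m) one_pos one_pos
    exact ⟨p0, p1, p2, p12, hh.trans (hq _ h1m)⟩
  have locA : ∀ s, |s| ≤ l₀ → ∀ τ ∈ T₁ ×ˢ T₂, 0 < (polymerPartitionFunction inc (wA s) (Λ \ H₂ τ.2)).re ∧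
      0 < (polymerPartitionFunction inc (wA 0) (Λ \ H₂ τ.2)).re ∧
      |Real.log (A s τ) - Real.log (A 0 τ) -
        Real.log ((polymerPartitionFunction inc (wA s) (Λ \ H₂ τ.2)).re / (polymerPartitionFunction inc (wA 0) (Λ \ H₂ τ.2)).re)| ≤ s' := by
    intro s hs τ hτ
    obtain ⟨h1m, h2m⟩ := mem hτ
    obtain ⟨p2, p2₀, -, -, hh⟩ := localResponse_of_holeSource (d := fun γ => d γ + e γ) ha hde (h1 (hωA s hs)) (h1 (hωA 0 h0)) (hAr s) (hAr 0)
      (hH₁ _ h1m) (H₂ := H₂ τ.2) (S := S) (fun γ hγ hγS => hSA s hs γ (Finset.sdiff_subset hγ) hγS) (hsep₂ _ h1m _ h2m)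
      (hF₁A _ h1m) (hF₂A _ h2m)
    exact ⟨p2, p2₀, hh.trans (hs' _ h1m)⟩
  -- the reference laws of G §5: `a₁ τ₁ := F₁A Z_A0(Λ∖H₁)`, `μ τ₂ := F₂A Z_A0(Λ∖H₂)/Z_A0(Λ)`, `ρ̄_s τ₂ := Z_As(Λ∖H₂)/Z_A0(Λ∖H₂)`,
  -- `u τ₁ := (F₁B Z_B0(Λ∖H₁))/(F₁A Z_A0(Λ∖H₁)) · Z_A0(Λ)/Z_B0(Λ) · e^{c₂}`
  obtain ⟨σ₁, hσ₁⟩ := hT₁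
  obtain ⟨σ₂, hσ₂⟩ := hT₂
  have hT₁' : T₁.Nonempty := ⟨σ₁, hσ₁⟩
  have hT₂' : T₂.Nonempty := ⟨σ₂, hσ₂⟩
  have pΛA : 0 < (polymerPartitionFunction inc (wA 0) Λ).re := (twoA (σ₁, σ₂) (Finset.mem_product.2 ⟨hσ₁, hσ₂⟩)).1
  have pΛB : 0 < (polymerPartitionFunction inc (wB 0) Λ).re := (twoB (σ₁, σ₂) (Finset.mem_product.2 ⟨hσ₁, hσ₂⟩)).1
  have pA1 : ∀ τ₁ ∈ T₁, 0 < (polymerPartitionFunction inc (wA 0) (Λ \ H₁ τ₁)).re := fun τ₁ h => (twoA (τ₁, σ₂) (Finset.mem_product.2 ⟨h, hσ₂⟩)).2.1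
  have pB1 : ∀ τ₁ ∈ T₁, 0 < (polymerPartitionFunction inc (wB 0) (Λ \ H₁ τ₁)).re := fun τ₁ h => (twoB (τ₁, σ₂) (Finset.mem_product.2 ⟨h, hσ₂⟩)).2.1
  have pA2 : ∀ s, |s| ≤ l₀ → ∀ τ₂ ∈ T₂, 0 < (polymerPartitionFunction inc (wA s) (Λ \ H₂ τ₂)).re := fun s hs τ₂ h =>
    (locA s hs (σ₁, τ₂) (Finset.mem_product.2 ⟨hσ₁, h⟩)).1
  have pB2 : ∀ τ₂ ∈ T₂, 0 < (polymerPartitionFunction inc (wB 0) (Λ \ H₂ τ₂)).re := fun τ₂ h => (twoB (σ₁, τ₂) (Finset.mem_product.2 ⟨hσ₁, h⟩)).2.2.1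
  -- the reference objects of G §5
  set a₁ : ι₁ → ℝ := fun τ₁ => F₁A τ₁ * (polymerPartitionFunction inc (wA 0) (Λ \ H₁ τ₁)).re with ha₁def
  set μ : ι₂ → ℝ := fun τ₂ => F₂A τ₂ * (polymerPartitionFunction inc (wA 0) (Λ \ H₂ τ₂)).re / (polymerPartitionFunction inc (wA 0) Λ).re with hμdef
  set ρbar : ℝ → ι₂ → ℝ := fun s τ₂ =>
    (polymerPartitionFunction inc (wA s) (Λ \ H₂ τ₂)).re / (polymerPartitionFunction inc (wA 0) (Λ \ H₂ τ₂)).re with hρdef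
  set u : ι₁ → ℝ := fun τ₁ => (F₁B τ₁ * (polymerPartitionFunction inc (wB 0) (Λ \ H₁ τ₁)).re) /
      (F₁A τ₁ * (polymerPartitionFunction inc (wA 0) (Λ \ H₁ τ₁)).re) *
      ((polymerPartitionFunction inc (wA 0) Λ).re / (polymerPartitionFunction inc (wB 0) Λ).re) * Real.exp c₂ with hudef
  have ha₁pos : ∀ τ₁ ∈ T₁, 0 < a₁ τ₁ := fun τ₁ h => mul_pos (hF₁A τ₁ h) (pA1 τ₁ h)
  have hμpos : ∀ τ₂ ∈ T₂, 0 < μ τ₂ := fun τ₂ h => div_pos (mul_pos (hF₂A τ₂ h) (pA2 0 h0 τ₂ h)) pΛA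
  have hρpos : ∀ s, |s| ≤ l₀ → ∀ τ₂ ∈ T₂, 0 < ρbar s τ₂ := fun s hs τ₂ h => div_pos (pA2 s hs τ₂ h) (pA2 0 h0 τ₂ h)
  have hupos : ∀ τ₁ ∈ T₁, 0 < u τ₁ := fun τ₁ h =>
    mul_pos (mul_pos (div_pos (mul_pos (hF₁B τ₁ h) (pB1 τ₁ h)) (mul_pos (hF₁A τ₁ h) (pA1 τ₁ h))) (div_pos pΛA pΛB)) (Real.exp_pos _)
  -- (quasi-old contrast) `|log B_0 − log(u A_0)| ≤ η₂ + 2q`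
  have hQO : ∀ τ ∈ T₁ ×ˢ T₂, |Real.log (B 0 τ) - Real.log (u τ.1 * A 0 τ)| ≤ η₂ + 2 * q := by
    intro τ hτ
    obtain ⟨h1m, h2m⟩ := mem hτ
    obtain ⟨-, -, -, pA12, hhA⟩ := twoA τ hτ
    obtain ⟨-, -, -, pB12, hhB⟩ := twoB τ hτ
    have hrec := hRecent _ h2m
    simp only [one_mul] at hhA hhB
    rw [Real.log_mul (pA1 _ h1m).ne' (div_pos (pA2 0 h0 _ h2m) pΛA).ne', Real.log_div (pA2 0 h0 _ h2m).ne' pΛA.ne'] at hhA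
    rw [Real.log_mul (pB1 _ h1m).ne' (div_pos (pB2 _ h2m) pΛB).ne', Real.log_div (pB2 _ h2m).ne' pΛB.ne'] at hhB
    have pA0 : 0 < A 0 τ := (key 0 h0 τ hτ).2.1
    have eB : Real.log (B 0 τ) = Real.log (F₁B τ.1) + Real.log (F₂B τ.2) +
        Real.log (polymerPartitionFunction inc (wB 0) (Λ \ (H₁ τ.1 ∪ H₂ τ.2))).re := by
      simp only [hBdef]; rw [Real.log_mul (mul_pos (hF₁B _ h1m) (hF₂B _ h2m)).ne' pB12.ne', Real.log_mul (hF₁B _ h1m).ne' (hF₂B _ h2m).ne']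
    have eA : Real.log (A 0 τ) = Real.log (F₁A τ.1) + Real.log (F₂A τ.2) +
        Real.log (polymerPartitionFunction inc (wA 0) (Λ \ (H₁ τ.1 ∪ H₂ τ.2))).re := by
      simp only [hAdef]; rw [Real.log_mul (mul_pos (hF₁A _ h1m) (hF₂A _ h2m)).ne' pA12.ne', Real.log_mul (hF₁A _ h1m).ne' (hF₂A _ h2m).ne']
    have pnum := mul_pos (hF₁B _ h1m) (pB1 _ h1m)
    have pden := mul_pos (hF₁A _ h1m) (pA1 _ h1m)
    have eu : Real.log (u τ.1) = (Real.log (F₁B τ.1) + Real.log (polymerPartitionFunction inc (wB 0) (Λ \ H₁ τ.1)).re -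
          (Real.log (F₁A τ.1) + Real.log (polymerPartitionFunction inc (wA 0) (Λ \ H₁ τ.1)).re)) +
        (Real.log (polymerPartitionFunction inc (wA 0) Λ).re - Real.log (polymerPartitionFunction inc (wB 0) Λ).re) + c₂ := by
      simp only [hudef]
      rw [Real.log_mul (mul_pos (div_pos pnum pden) (div_pos pΛA pΛB)).ne' (Real.exp_pos _).ne', Real.log_exp,
        Real.log_mul (div_pos pnum pden).ne' (div_pos pΛA pΛB).ne', Real.log_div pnum.ne' pden.ne', Real.log_div pΛA.ne' pΛB.ne',
        Real.log_mul (hF₁B _ h1m).ne' (pB1 _ h1m).ne', Real.log_mul (hF₁A _ h1m).ne' (pA1 _ h1m).ne']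
    rw [Real.log_mul (hupos _ h1m).ne' pA0.ne', eu, eB, eA]
    rw [abs_le] at hhA hhB hrec ⊢
    constructor <;> linarith [hhA.1, hhA.2, hhB.1, hhB.2, hrec.1, hrec.2]
  -- (MIX) `|log A_0 − log(a₁ μ)| ≤ (2q)/2`
  have hMIXl : ∀ τ ∈ T₁ ×ˢ T₂, |Real.log (A 0 τ) - Real.log (a₁ τ.1 * μ τ.2)| ≤ 2 * q / 2 := by
    intro τ hτ
    obtain ⟨h1m, h2m⟩ := mem hτ
    obtain ⟨-, -, -, pA12, hhA⟩ := twoA τ hτ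
    have e : (2 * q) / 2 = q := by ring
    rw [e]
    have eA : Real.log (A 0 τ) = Real.log (F₁A τ.1) + Real.log (F₂A τ.2) +
        Real.log (polymerPartitionFunction inc (wA 0) (Λ \ (H₁ τ.1 ∪ H₂ τ.2))).re := by
      simp only [hAdef]; rw [Real.log_mul (mul_pos (hF₁A _ h1m) (hF₂A _ h2m)).ne' pA12.ne', Real.log_mul (hF₁A _ h1m).ne' (hF₂A _ h2m).ne']
    have eref : Real.log (a₁ τ.1 * μ τ.2) = Real.log (F₁A τ.1) + Real.log (polymerPartitionFunction inc (wA 0) (Λ \ H₁ τ.1)).re +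
        (Real.log (F₂A τ.2) + Real.log (polymerPartitionFunction inc (wA 0) (Λ \ H₂ τ.2)).re - Real.log (polymerPartitionFunction inc (wA 0) Λ).re) := by
      simp only [ha₁def, hμdef]
      rw [Real.log_mul (mul_pos (hF₁A _ h1m) (pA1 _ h1m)).ne' (div_pos (mul_pos (hF₂A _ h2m) (pA2 0 h0 _ h2m)) pΛA).ne',
        Real.log_mul (hF₁A _ h1m).ne' (pA1 _ h1m).ne', Real.log_div (mul_pos (hF₂A _ h2m) (pA2 0 h0 _ h2m)).ne' pΛA.ne',
        Real.log_mul (hF₂A _ h2m).ne' (pA2 0 h0 _ h2m).ne']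
    simp only [one_mul] at hhA
    rw [Real.log_mul (pA1 _ h1m).ne' (div_pos (pA2 0 h0 _ h2m) pΛA).ne', Real.log_div (pA2 0 h0 _ h2m).ne' pΛA.ne'] at hhA
    rw [eA, eref]
    rw [abs_le] at hhA ⊢
    constructor <;> linarith [hhA.1, hhA.2]
  -- (LOC)
  have hLOCl : ∀ s, |s| ≤ l₀ → ∀ τ ∈ T₁ ×ˢ T₂, |Real.log (A s τ) - Real.log (A 0 τ) - Real.log (ρbar s τ.2)| ≤ s' :=
    fun s hs τ hτ => (locA s hs τ hτ).2.2
  -- (DC) from G §5, then FILE C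
  have hDC : ∀ s, |s| ≤ l₀ → |Real.log (∑ τ ∈ T₁ ×ˢ T₂, B 0 τ * (A s τ / A 0 τ)) - Real.log (∑ τ ∈ T₁ ×ˢ T₂, B 0 τ) -
      (Real.log (∑ τ ∈ T₁ ×ˢ T₂, A s τ) - Real.log (∑ τ ∈ T₁ ×ˢ T₂, A 0 τ))| ≤ 2 * (2 * q + s' + (η₂ + 2 * q)) := fun s hs =>
    decorrelation_of_quasiProduct_of_localResponse_of_quasiOldContrast (A := A) (B := B) hT₁' hT₂' (fun s hs τ hτ => (key s hs τ hτ).1)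
      (fun τ hτ => (key 0 h0 τ hτ).2.2.2.1) hl₀ ha₁pos hμpos hρpos hupos hQO hMIXl hLOCl hs
  exact abs_genFunIncr_sub_le_of_response_decorrelation (T := T₁ ×ˢ T₂) (A := A) (B := B) (Finset.Nonempty.product hT₁' hT₂')
    (fun s hs τ hτ => (key s hs τ hτ).1) (fun s hs τ hτ => (key s hs τ hτ).2.2.1) hl₀ (fun s hs τ hτ => (key s hs τ hτ).2.2.2.2) hDC ht

end Summit.QuantumFields.YangMills.BalabanUVNodes.N19TwoHoleClassGasRoad

end
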